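import Summits.CriticalPhenomena.PercolationContinuityZ3.Theorems.PercNearOneGluingNoHeavyLowerTailTwoDownsetMatching
import Summits.CriticalPhenomena.PercolationContinuityZ3.Theorems.PercNearOneGluingNoHeavyLowerTailThreePartitionRowColumn

/-!
# `NoHeavyLowerTail` (crux stmt-CriticalPhenomena-4575): the SHARED KLEITMAN–HALL statement is a theorem —
# the column half of Conjecture V (support file)

Support file (lineage `prim-bnk-2`, generation 28; `--supports stmt-CriticalPhenomena-4575`; memo
`run/shared/lean/prim/prim-l12/FROM-prim-bnk-2-g28-SHARED-KH-PROVED.md`).  No definitions, no `sorry`, standard axioms.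

Generation 27 (`…ThreePartitionRowColumn`) split the kernel of Conjecture V as `vSumT = colPart + rowPart`, proved the row half
(`rowPart_nonneg`, Theorem A) and isolated the column half as the `@[conjecture]` `ColumnSharedKleitmanHall`: on every column of the
twisted three-partition count, for up-sets `U, B, C` of the column cube `2^R` (`c` = complement of `a` in `R`),
  `#(a∈U, a∈C∖B, c∈B) + #(a∈U, a∈B∖C, c∈B∩C) ≤ #(a∈U, a∈B∩C, c∉B∩C)`.
This file PROVES it (`columnSharedKleitmanHall`).  Proof (memo §1): with `E := (B ∖ σB) ∪ (B∩C)` (an up-set), `L := σE ∖ E`,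
`𝒜 := L ∖ B`, `𝒞 := L ∩ σC` (two down-sets with `𝒜 ∪ 𝒞 = L`), THEOREM T of the companion file `…TwoDownsetMatching`
(`SahiFComb.Shift.exists_disjoint_equiv_of_union`) gives a bijection `φ : L → σL`, `x ⊆ φ x`, with `φ x ∈ C` whenever `x ∈ B`; it maps
the two source classes (both inside `L`) injectively into `(B∩C) ∖ σ(B∩C)`, upward, and an upward injection bounds the up-set counts.
Consequences recorded here: `colPart + #X ≥ 0` unconditionally (`colPart_add_cross_nonneg`, `X` the crossing class) and hence
`vSumT ≥ −#X` (`vSumT_add_cross_nonneg`): Conjecture V is now exactly the absorption of the crossing class (memo g27 §2). [this work]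
-/

namespace Summit.CriticalPhenomena.PercolationContinuityZ3.Theorems

open Finset
open scoped symmDiff Classical

noncomputable section

namespace ThreePartition

variable {ι : Type*} [Fintype ι]

/-! ## THEOREM T transported to families of `Set ι` -/

/-- THEOREM T (`SahiFComb.Shift.exists_disjoint_equiv_of_union`) for families of subsets of a finite type, written with `Set ι`:
for down-closed `𝒜, 𝒞 ⊆ 𝒫(ι)` there is a bijection `ψ` of `𝒜 ∪ 𝒞` with `x ∩ ψ x = ∅` and (`x ∈ 𝒜` or `ψ x ∈ 𝒞`).
(Transport along `Set ι ≃ Finset ι`.) [this work] -/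
theorem exists_disjoint_equiv_of_union_set (𝒜 𝒞 : Finset (Set ι))
    (h𝒜 : ∀ K ∈ 𝒜, ∀ K' ⊆ K, K' ∈ 𝒜) (h𝒞 : ∀ K ∈ 𝒞, ∀ K' ⊆ K, K' ∈ 𝒞) :
    ∃ ψ : ↥(𝒜 ∪ 𝒞) ≃ ↥(𝒜 ∪ 𝒞), ∀ x : ↥(𝒜 ∪ 𝒞),
      Disjoint (x : Set ι) ((ψ x : ↥(𝒜 ∪ 𝒞)) : Set ι) ∧
        ((x : Set ι) ∈ 𝒜 ∨ ((ψ x : ↥(𝒜 ∪ 𝒞)) : Set ι) ∈ 𝒞) := by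
  classical
  letI : LinearOrder ι := LinearOrder.lift' (Fintype.equivFin ι) (Fintype.equivFin ι).injective
  let e : Set ι ≃ Finset ι := Fintype.finsetEquivSet.symm
  have he : ∀ s : Set ι, ((e s : Finset ι) : Set ι) = s := fun s => Fintype.finsetEquivSet.apply_symm_apply s
  have hes : ∀ F : Finset ι, e.symm F = (F : Set ι) := fun F => rfl
  let 𝒜' : Finset (Finset ι) := 𝒜.map e.toEmbedding
  let 𝒞' : Finset (Finset ι) := 𝒞.map e.toEmbedding
  have hmem𝒜 : ∀ F : Finset ι, F ∈ 𝒜' ↔ (F : Set ι) ∈ 𝒜 := fun F => by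
    rw [Finset.mem_map_equiv, hes]
  have hmem𝒞 : ∀ F : Finset ι, F ∈ 𝒞' ↔ (F : Set ι) ∈ 𝒞 := fun F => by
    rw [Finset.mem_map_equiv, hes]
  have h𝒜' : ∀ K ∈ 𝒜', ∀ K' ⊆ K, K' ∈ 𝒜' := fun K hK K' hK' =>
    (hmem𝒜 K').2 (h𝒜 _ ((hmem𝒜 K).1 hK) _ (Finset.coe_subset.2 hK'))
  have h𝒞' : ∀ K ∈ 𝒞', ∀ K' ⊆ K, K' ∈ 𝒞' := fun K hK K' hK' =>
    (hmem𝒞 K').2 (h𝒞 _ ((hmem𝒞 K).1 hK) _ (Finset.coe_subset.2 hK'))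
  obtain ⟨ψ', hψ'⟩ := SahiFComb.Shift.exists_disjoint_equiv_of_union h𝒜' h𝒞'
  have hiff : ∀ x : Set ι, x ∈ 𝒜 ∪ 𝒞 ↔ e x ∈ 𝒜' ∪ 𝒞' := fun x => by
    rw [mem_union, mem_union, hmem𝒜, hmem𝒞, he]
  let g : ↥(𝒜 ∪ 𝒞) ≃ ↥(𝒜' ∪ 𝒞') := e.subtypeEquiv hiff
  have hg : ∀ x : ↥(𝒜 ∪ 𝒞), ((g x : ↥(𝒜' ∪ 𝒞')) : Finset ι) = e x := fun x => rfl
  have hgs : ∀ y : ↥(𝒜' ∪ 𝒞'), ((g.symm y : ↥(𝒜 ∪ 𝒞)) : Set ι) = ((y : Finset ι) : Set ι) := fun y => rfl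
  refine ⟨g.trans (ψ'.trans g.symm), fun x => ?_⟩
  have h1 := hψ' (g x)
  rw [hg] at h1
  have hcoe : (((g.trans (ψ'.trans g.symm)) x : ↥(𝒜 ∪ 𝒞)) : Set ι) = ((ψ' (g x) : Finset ι) : Set ι) := by
    rw [Equiv.trans_apply, Equiv.trans_apply, hgs]
  rw [hcoe]
  refine ⟨?_, ?_⟩
  · have hd := Finset.disjoint_coe.2 h1.1
    rwa [he] at hd
  · rcases h1.2 with h | h
    · left; rwa [hmem𝒜, he] at h
    · right; rwa [hmem𝒞] at h

/-! ## Shared Kleitman–Hall on one column of the twisted three-partition count -/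

/-- **Shared Kleitman–Hall, one column** (memo §1, COROLLARY (C2)).  On the folding fibre `{b : b \ Sᶜ = S ∩ τ}` (a copy of the cube
`2^{Sᶜ}`, third copy `c = b ∆ Sᶜ`), for up-sets `U, V, W`:
`#(b∈U, b∈W∖V, c∈V) + #(b∈U, b∈V∖W, c∈V∩W) ≤ #(b∈U, b∈V∩W, c∉V∩W)`. [this work] -/
theorem card_sharedKH_fibre (S τ : Set ι) {U V W : Set (Set ι)}
    (hU : IsUpperSet U) (hV : IsUpperSet V) (hW : IsUpperSet W) :
    #(univ.filter fun b : Set ι => b \ Sᶜ = S ∩ τ ∧ (b ∈ U ∧ (b ∈ W ∧ b ∉ V) ∧ b ∆ Sᶜ ∈ V)) +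
      #(univ.filter fun b : Set ι => b \ Sᶜ = S ∩ τ ∧ (b ∈ U ∧ (b ∈ V ∧ b ∉ W) ∧ b ∆ Sᶜ ∈ V ∧ b ∆ Sᶜ ∈ W)) ≤
      #(univ.filter fun b : Set ι => b \ Sᶜ = S ∩ τ ∧ (b ∈ U ∧ (b ∈ V ∧ b ∈ W) ∧ ¬ (b ∆ Sᶜ ∈ V ∧ b ∆ Sᶜ ∈ W))) := by
  classical
  set R : Set ι := Sᶜ with hR
  set t : Set ι := S ∩ τ with ht
  have htR : ∀ i, i ∈ t → i ∉ R := fun i hi hiR => by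
    rw [hR, Set.mem_compl_iff] at hiR
    exact hiR (Set.inter_subset_left hi)
  -- the column cube: `lift x = x ∪ t`, `co x = R \ x`
  let lift : Set ι → Set ι := fun x => x ∪ t
  let co : Set ι → Set ι := fun x => R \ x
  let inV : Set ι → Prop := fun x => lift x ∈ V
  let inW : Set ι → Prop := fun x => lift x ∈ W
  let inU : Set ι → Prop := fun x => lift x ∈ U
  let E : Set ι → Prop := fun x => inV x ∧ (¬ inV (co x) ∨ inW x)
  have lift_mono : ∀ {x x' : Set ι}, x ⊆ x' → lift x ⊆ lift x' := fun h => Set.union_subset_union_left _ h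
  have co_anti : ∀ {x x' : Set ι}, x ⊆ x' → co x' ⊆ co x := fun h i hi => ⟨hi.1, fun hi' => hi.2 (h hi')⟩
  have co_sub : ∀ x : Set ι, co x ⊆ R := fun x i hi => hi.1
  have co_co : ∀ {x : Set ι}, x ⊆ R → co (co x) = x := by
    intro x hx
    ext i
    simp only [co, Set.mem_sdiff, not_and, not_not]
    exact ⟨fun h => h.2 h.1, fun h => ⟨hx h, fun _ => h⟩⟩
  have inV_mono : ∀ {x x' : Set ι}, x ⊆ x' → inV x → inV x' := fun h hx => hV (lift_mono h) hx
  have inW_mono : ∀ {x x' : Set ι}, x ⊆ x' → inW x → inW x' := fun h hx => hW (lift_mono h) hx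
  have inU_mono : ∀ {x x' : Set ι}, x ⊆ x' → inU x → inU x' := fun h hx => hU (lift_mono h) hx
  have E_mono : ∀ {x x' : Set ι}, x ⊆ x' → E x → E x' := fun h hx =>
    ⟨inV_mono h hx.1, hx.2.imp (fun hn hc => hn (inV_mono (co_anti h) hc)) (inW_mono h)⟩
  -- the two down-closed families `𝒜 = L ∖ B`, `𝒞 = L ∩ σC` of the column cube
  let 𝒜 : Finset (Set ι) := univ.filter fun x => x ⊆ R ∧ ¬ E x ∧ E (co x) ∧ ¬ inV x
  let 𝒞 : Finset (Set ι) := univ.filter fun x => x ⊆ R ∧ ¬ E x ∧ E (co x) ∧ inW (co x)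
  have hm𝒜 : ∀ x, x ∈ 𝒜 ↔ x ⊆ R ∧ ¬ E x ∧ E (co x) ∧ ¬ inV x := fun x => by
    simp only [𝒜, mem_filter, mem_univ, true_and]
  have hm𝒞 : ∀ x, x ∈ 𝒞 ↔ x ⊆ R ∧ ¬ E x ∧ E (co x) ∧ inW (co x) := fun x => by
    simp only [𝒞, mem_filter, mem_univ, true_and]
  have h𝒜 : ∀ K ∈ 𝒜, ∀ K' ⊆ K, K' ∈ 𝒜 := by
    intro K hK K' hK'
    rw [hm𝒜] at hK ⊢
    obtain ⟨hKR, hKE, hKco, hKV⟩ := hK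
    exact ⟨hK'.trans hKR, fun h => hKE (E_mono hK' h), E_mono (co_anti hK') hKco, fun h => hKV (inV_mono hK' h)⟩
  have h𝒞 : ∀ K ∈ 𝒞, ∀ K' ⊆ K, K' ∈ 𝒞 := by
    intro K hK K' hK'
    rw [hm𝒞] at hK ⊢
    obtain ⟨hKR, hKE, hKco, hKW⟩ := hK
    exact ⟨hK'.trans hKR, fun h => hKE (E_mono hK' h), E_mono (co_anti hK') hKco, inW_mono (co_anti hK') hKW⟩
  have hL : ∀ x : Set ι, x ∈ 𝒜 ∪ 𝒞 ↔ x ⊆ R ∧ ¬ E x ∧ E (co x) := by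
    intro x
    rw [mem_union, hm𝒜, hm𝒞]
    constructor
    · rintro (⟨h1, h2, h3, -⟩ | ⟨h1, h2, h3, -⟩) <;> exact ⟨h1, h2, h3⟩
    · rintro ⟨h1, h2, h3⟩
      by_cases hv : inV x
      · refine Or.inr ⟨h1, h2, h3, ?_⟩
        rcases h3.2 with hn | hw
        · rw [co_co h1] at hn; exact absurd hv hn
        · exact hw
      · exact Or.inl ⟨h1, h2, h3, hv⟩
  obtain ⟨ψ, hψ⟩ := exists_disjoint_equiv_of_union_set 𝒜 𝒞 h𝒜 h𝒞
  -- the dominating map `x ↦ co (ψ x)` and its properties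
  have key : ∀ x : ↥(𝒜 ∪ 𝒞), (x : Set ι) ⊆ co (ψ x) ∧ E (co (ψ x)) ∧ ¬ E ((ψ x : ↥(𝒜 ∪ 𝒞)) : Set ι) ∧
      (((ψ x : ↥(𝒜 ∪ 𝒞)) : Set ι) ⊆ R) ∧ (inV x → inW (co (ψ x))) := by
    intro x
    obtain ⟨hxR, -, -⟩ := (hL x).1 x.2
    obtain ⟨hyR, hyE, hyco⟩ := (hL _).1 (ψ x).2
    refine ⟨fun i hi => ⟨hxR hi, fun hi' => Set.disjoint_left.1 (hψ x).1 hi hi'⟩, hyco, hyE, hyR, fun hv => ?_⟩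
    have hxA : (x : Set ι) ∉ 𝒜 := fun h => ((hm𝒜 _).1 h).2.2.2 hv
    exact ((hm𝒞 _).1 ((hψ x).2.resolve_left hxA)).2.2.2
  -- fibre dictionary
  have fib1 : ∀ b : Set ι, b \ R = t → lift (b ∩ R) = b := by
    intro b hb
    ext i
    simp only [lift, Set.mem_union, Set.mem_inter_iff, ← hb, Set.mem_sdiff]
    tauto
  have fib2 : ∀ b : Set ι, b \ R = t → b ∆ R = lift (co (b ∩ R)) := by
    intro b hb
    ext i
    simp only [lift, co, Set.mem_symmDiff, Set.mem_union, Set.mem_sdiff, Set.mem_inter_iff, ← hb]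
    tauto
  have fib3 : ∀ x : Set ι, x ⊆ R → lift x \ R = t := by
    intro x hx
    ext i
    simp only [lift, Set.mem_sdiff, Set.mem_union]
    constructor
    · rintro ⟨h | h, hR'⟩
      · exact absurd (hx h) hR'
      · exact h
    · exact fun h => ⟨Or.inr h, htR i h⟩
  have fib4 : ∀ x : Set ι, x ⊆ R → lift x ∩ R = x := by
    intro x hx
    ext i
    simp only [lift, Set.mem_inter_iff, Set.mem_union]
    constructor
    · rintro ⟨h | h, hR'⟩
      · exact h
      · exact absurd hR' (htR i h)
    · exact fun h => ⟨Or.inl h, hx h⟩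
  have fib5 : ∀ x : Set ι, x ⊆ R → lift x ∆ R = lift (co x) := by
    intro x hx
    rw [fib2 (lift x) (fib3 x hx), fib4 x hx]
  -- the injection on the fibre
  let Φ : Set ι → Set ι := fun b =>
    if h : b ∩ R ∈ 𝒜 ∪ 𝒞 then lift (co (ψ ⟨b ∩ R, h⟩ : ↥(𝒜 ∪ 𝒞))) else b
  -- sources lie in `L = 𝒜 ∪ 𝒞`
  have src_mem : ∀ b : Set ι, b \ R = t →
      ((b ∈ W ∧ b ∉ V) ∧ b ∆ R ∈ V) ∨ ((b ∈ V ∧ b ∉ W) ∧ b ∆ R ∈ V ∧ b ∆ R ∈ W) → b ∩ R ∈ 𝒜 ∪ 𝒞 := by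
    intro b hb h
    have e1 : lift (b ∩ R) = b := fib1 b hb
    have e2 : b ∆ R = lift (co (b ∩ R)) := fib2 b hb
    rw [hL]
    refine ⟨Set.inter_subset_right, ?_, ?_⟩
    · rintro ⟨hv, hn | hw⟩
      · change lift (b ∩ R) ∈ V at hv; rw [e1] at hv
        change lift (co (b ∩ R)) ∉ V at hn; rw [← e2] at hn
        rcases h with ⟨⟨-, hbV⟩, -⟩ | ⟨-, hcV, -⟩
        · exact hbV hv
        · exact hn hcV
      · change lift (b ∩ R) ∈ V at hv; rw [e1] at hv
        change lift (b ∩ R) ∈ W at hw; rw [e1] at hw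
        rcases h with ⟨⟨-, hbV⟩, -⟩ | ⟨⟨-, hbW⟩, -⟩
        · exact hbV hv
        · exact hbW hw
    · refine ⟨?_, ?_⟩
      · change lift (co (b ∩ R)) ∈ V; rw [← e2]
        rcases h with ⟨-, hcV⟩ | ⟨-, hcV, -⟩ <;> exact hcV
      · rw [co_co Set.inter_subset_right]
        change lift (b ∩ R) ∉ V ∨ lift (co (b ∩ R)) ∈ W
        rw [e1, ← e2]
        rcases h with ⟨⟨-, hbV⟩, -⟩ | ⟨-, -, hcW⟩
        · exact Or.inl hbV
        · exact Or.inr hcW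
  -- disjointness of the two source classes, then the injection bound
  rw [← card_union_of_disjoint (disjoint_filter.2 fun b _ h1 h2 => h2.2.2.1.2 h1.2.2.1.1)]
  refine card_le_card_of_injOn Φ (fun b hb => ?_) (fun b₁ hb₁ b₂ hb₂ heq => ?_)
  · -- `Φ` maps sources to targets
    simp only [coe_union, coe_filter, Set.mem_union, Set.mem_setOf_eq, mem_univ, true_and] at hb
    have hbR : b \ R = t := by rcases hb with h | h <;> exact h.1
    have hbU : b ∈ U := by rcases hb with h | h <;> exact h.2.1
    have hsrc : ((b ∈ W ∧ b ∉ V) ∧ b ∆ R ∈ V) ∨ ((b ∈ V ∧ b ∉ W) ∧ b ∆ R ∈ V ∧ b ∆ R ∈ W) := by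
      rcases hb with h | h
      · exact Or.inl h.2.2
      · exact Or.inr h.2.2
    have hx : b ∩ R ∈ 𝒜 ∪ 𝒞 := src_mem b hbR hsrc
    obtain ⟨k1, k2, k3, k4, k5⟩ := key ⟨b ∩ R, hx⟩
    have hΦ : Φ b = lift (co ((ψ ⟨b ∩ R, hx⟩ : ↥(𝒜 ∪ 𝒞)) : Set ι)) := by simp only [Φ, dif_pos hx]
    rw [mem_coe, mem_filter, hΦ]
    refine ⟨mem_univ _, fib3 _ (co_sub _), ?_, ⟨k2.1, ?_⟩, ?_⟩
    · -- `U` is an up-set and `b ∩ R ⊆ co y`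
      have : inU (b ∩ R) := by change lift (b ∩ R) ∈ U; rw [fib1 b hbR]; exact hbU
      exact inU_mono k1 this
    · -- membership in `W`
      rcases hsrc with ⟨⟨hbW, -⟩, -⟩ | ⟨⟨hbV, -⟩, -⟩
      · have : inW (b ∩ R) := by change lift (b ∩ R) ∈ W; rw [fib1 b hbR]; exact hbW
        exact inW_mono k1 this
      · have : inV (b ∩ R) := by change lift (b ∩ R) ∈ V; rw [fib1 b hbR]; exact hbV
        exact k5 this
    · -- the target is high: its third copy `lift (ψ x)` is not in `V ∩ W` since `ψ x ∉ E`
      rw [fib5 _ (co_sub _), co_co k4]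
      intro hc
      exact k3 ⟨hc.1, Or.inr hc.2⟩
  · -- `Φ` is injective on sources
    simp only [coe_union, coe_filter, Set.mem_union, Set.mem_setOf_eq, mem_univ, true_and] at hb₁ hb₂
    have hbR₁ : b₁ \ R = t := by rcases hb₁ with h | h <;> exact h.1
    have hbR₂ : b₂ \ R = t := by rcases hb₂ with h | h <;> exact h.1
    have hx₁ : b₁ ∩ R ∈ 𝒜 ∪ 𝒞 := src_mem b₁ hbR₁ (by
      rcases hb₁ with h | h
      · exact Or.inl h.2.2
      · exact Or.inr h.2.2)
    have hx₂ : b₂ ∩ R ∈ 𝒜 ∪ 𝒞 := src_mem b₂ hbR₂ (by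
      rcases hb₂ with h | h
      · exact Or.inl h.2.2
      · exact Or.inr h.2.2)
    have h1 : Φ b₁ = lift (co (ψ ⟨b₁ ∩ R, hx₁⟩ : ↥(𝒜 ∪ 𝒞))) := by simp only [Φ, dif_pos hx₁]
    have h2 : Φ b₂ = lift (co (ψ ⟨b₂ ∩ R, hx₂⟩ : ↥(𝒜 ∪ 𝒞))) := by simp only [Φ, dif_pos hx₂]
    rw [h1, h2] at heq
    have h3 := congrArg (fun s => co (s ∩ R)) heq
    simp only [fib4 _ (co_sub _), co_co (key _).2.2.2.1] at h3
    have h4 : (⟨b₁ ∩ R, hx₁⟩ : ↥(𝒜 ∪ 𝒞)) = ⟨b₂ ∩ R, hx₂⟩ := ψ.injective (Subtype.ext h3)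
    have h5 : b₁ ∩ R = b₂ ∩ R := congrArg Subtype.val h4
    rw [← fib1 b₁ hbR₁, ← fib1 b₂ hbR₂, h5]

/-! ## The column half of Conjecture V -/

/-- **SHARED KLEITMAN–HALL** (g27's `ColumnSharedKleitmanHall`, PROVED): for all up-sets `𝒱, 𝒲`, every twist and every copy-order up-set
`𝒳`, `#(a∈𝒲∖𝒱 | · | c∈𝒱) + #(a∈𝒱∖𝒲 | · | c∈𝒱𝒲) ≤ #(a∈𝒱𝒲 | · | c∉𝒱𝒲)` — column by column this is `card_sharedKH_fibre`. [this work] -/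
theorem columnSharedKleitmanHall : ColumnSharedKleitmanHall := by
  intro ι _ τ 𝒱 𝒲 𝒳 h𝒱 h𝒲 h𝒳
  rw [triT_eq_sum_snd, triT_eq_sum_snd, triT_eq_sum_snd, ← Finset.sum_add_distrib]
  refine Finset.sum_le_sum fun S _ => ?_
  have hU : IsUpperSet {b : Set ι | (b, S ∆ τ) ∈ 𝒳} := fun b b' hle hb =>
    h𝒳 (Prod.mk_le_mk.2 ⟨hle, le_rfl⟩) hb
  have h := card_sharedKH_fibre S τ hU h𝒱 h𝒲
  simp only [Set.mem_setOf_eq] at h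
  convert h using 6; rfl

/-- **The column half of Conjecture V, unconditionally**: `colPart + #X ≥ 0`, `X = (a∈𝒱∖𝒲 | · | c∈𝒲∖𝒱)` the crossing class
(g27's `colPart_add_cross_nonneg_of` with its hypothesis discharged). [this work] -/
theorem colPart_add_cross_nonneg {ι : Type} [Fintype ι] (τ : Set ι) {𝒱 𝒲 : Set (Set ι)} {𝒳 : Set (Set ι × Set ι)}
    (h𝒱 : IsUpperSet 𝒱) (h𝒲 : IsUpperSet 𝒲) (h𝒳 : IsUpperSet 𝒳) :
    0 ≤ colPart τ 𝒱 𝒲 𝒳 + triT τ (fun a b c => (a, b) ∈ 𝒳 ∧ (a ∈ 𝒱 ∧ a ∉ 𝒲) ∧ c ∈ 𝒲 ∧ c ∉ 𝒱) :=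
  colPart_add_cross_nonneg_of columnSharedKleitmanHall τ h𝒱 h𝒲 h𝒳

/-- **Conjecture V up to the crossing class**: `vSumT + #X ≥ 0` for all up-sets `𝒱, 𝒲`, every twist and every copy-order up-set `𝒳`
(`vSumT = colPart + rowPart`, `rowPart ≥ 0` by Theorem A, `colPart ≥ −#X` by shared Kleitman–Hall).  Conjecture V itself
(`VOrderPositivity`: `vSumT ≥ 0`) is thus exactly the absorption of the `N_×` crossing units (memo g27 §2). [this work] -/
theorem vSumT_add_cross_nonneg {ι : Type} [Fintype ι] (τ : Set ι) {𝒱 𝒲 : Set (Set ι)} {𝒳 : Set (Set ι × Set ι)}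
    (h𝒱 : IsUpperSet 𝒱) (h𝒲 : IsUpperSet 𝒲) (h𝒳 : IsUpperSet 𝒳) :
    0 ≤ vSumT τ 𝒱 𝒲 𝒳 + triT τ (fun a b c => (a, b) ∈ 𝒳 ∧ (a ∈ 𝒱 ∧ a ∉ 𝒲) ∧ c ∈ 𝒲 ∧ c ∉ 𝒱) := by
  rw [vSumT_eq_colPart_add_rowPart, add_right_comm]
  exact add_nonneg (colPart_add_cross_nonneg τ h𝒱 h𝒲 h𝒳) (rowPart_nonneg τ h𝒱 h𝒲 h𝒳)

end ThreePartition

end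

end Summit.CriticalPhenomena.PercolationContinuityZ3.Theorems
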